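import Literature.Probability.RandomPlanarGeometry.HullRestrictionNull
import Literature.Probability.RandomPlanarGeometry.KernelConvergence
import Literature.Probability.RandomPlanarGeometry.HalfPlaneFillProofs
import Literature.Probability.RandomPlanarGeometry.JordanDomainProofs
import Literature.Probability.RandomPlanarGeometry.ConformalMapCaratheodoryProofs
import Literature.Topology.PlaneTopology.JordanCurveProofs
import HarnessLib

/-!
# Crux `SAWDevelopingMap.ObservableToSLE` (stmt-CriticalPhenomena-10472), line
`floor-ratio-restriction-bootstrap`, stub `stub_hullApproxLimit` (STUB 4a, the analytic half of (HA))

Landing target: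
`Summits/CriticalPhenomena/SAWScalingLimit/Theorems/SAWDevelopingMapObservableToSLEHullApproxLimit.lean`
(`--supports stmt-CriticalPhenomena-10472`).

For a hull subdomain `D'` of a Dobrushin domain `D` with chordal uniformizer `φ : ℍ → D`, the
pulled-back hull `A := φ.pullbackHull D' = closure (ℍ ∖ φ⁻¹ D')` is a `*`-hull
(`IsStarHull.pullbackHull`), exhausted from inside by the anchored hulls
`B_n := anchoredHull (erosion φ D' n)` of its erosions (`HullRestrictionNull`): `*`-hulls, increasing,
inside `A`, with kernel `ℍ ∖ A` (`interior_iInter_diff_anchoredHull_erosion`). By the continuity of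
`Φ'_·(0)` under kernel convergence (`HasRestrictionDeriv.tendsto_of_kernel_holds`, [LSW] proof of
Lemma 3.5 with the Carathéodory kernel theorem) `Φ'_{B_n}(0) → Φ'_A(0) > 0`, so some `B_n` has
`Φ'_{B_n}(0)^{5/8} ≤ (1 + ε) Φ'_A(0)^{5/8}`; by monotonicity (`HasRestrictionDeriv.le_of_subset`,
[LSW] (2.4)) every pulled-back hull `A'' ⊇ B_n` has `Φ'_{A''}(0) ≤ Φ'_{B_n}(0)`. The metric margin:
points of `B_n ⊆ hpFill (erosion n)` are at distance `≥ 1/(n+1)` from `closure (φ⁻¹ D')` — a point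
of `ℍ` closer than that is joined, inside a small half-ball missing the erosion, to a point of
`φ⁻¹ D'`, which lies in the unbounded component of `ℍ ∖ erosion n`
(`pullbackDomain_subset_unboundedComponent`).

* `le_infDist_of_notMem_unboundedComponent` — the metric margin off the unbounded component;
* `le_infDist_of_mem_anchoredHull_erosion` — the metric margin on `B_n`;
* `stub_hullApproxLimit` — **the registered statement of STUB 4a, verbatim**.
-/

noncomputable section

open scoped Topology NNReal
open Filter Set MeasureTheory Metric
open Literature.Probability.RandomPlanarGeometry
open UpperHalfPlane (upperHalfPlaneSet)

namespace Summit.CriticalPhenomena.SAWScalingLimit.Theorems.ObservableToSLE.FloorRatio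

/-- **Metric margin off the unbounded component.** For a hull subdomain `D'` and a chordal
uniformizer `φ`, a point of `ℍ` off the unbounded component of `ℍ ∖ erosion φ D' n` is at distance
`≥ 1/(n+1)` from `closure (φ⁻¹ D')`: otherwise a half-ball around a nearby point of that closure
misses the erosion, is convex, and joins the point to `φ⁻¹ D'`, which lies in the unbounded
component (`pullbackDomain_subset_unboundedComponent`). [folklore] -/
theorem le_infDist_of_notMem_unboundedComponent {D D' : DobrushinDomain}
    {φ : ConformalEquiv upperHalfPlaneSet D.carrier} (hφ : D.IsChordalUniformizing φ)
    (hD' : D.IsHullSubdomain D') (n : ℕ) {w : ℂ} (hw : w ∈ upperHalfPlaneSet)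
    (hwV : w ∉ Loewner.unboundedComponent (upperHalfPlaneSet \ erosion φ D' n)) :
    1 / ((n : ℝ) + 1) ≤ infDist w (closure (φ.pullbackDomain D')) := by
  by_contra hlt
  push Not at hlt
  have hsc : ∀ D₀ : JordanDomain, D₀.isSimplyConnected := JordanDomain.isSimplyConnected_holds
  set F : Set ℂ := closure (φ.pullbackDomain D') with hF
  set ρ : ℝ := 1 / ((n : ℝ) + 1) with hρdef
  have hρ : 0 < ρ := by positivity
  have hFne : F.Nonempty := ⟨0, zero_mem_closure_pullbackDomain hφ hD' hsc⟩
  obtain ⟨f, hfF, hwf⟩ := (infDist_lt_iff hFne).1 hlt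
  obtain ⟨p, hpU, hfp⟩ := Metric.mem_closure_iff.1 hfF ρ hρ
  -- the half-ball `ball f ρ ∩ ℍ` misses the erosion and joins `w` to `p`
  set C : Set ℂ := ball f ρ ∩ upperHalfPlaneSet with hC
  have hCconv : Convex ℝ C := (convex_ball f ρ).inter (convex_halfSpace_im_gt 0)
  have hCsub : C ⊆ upperHalfPlaneSet \ erosion φ D' n := by
    rintro q ⟨hqf, hq⟩
    refine ⟨hq, fun hqS ↦ ?_⟩
    have h1 : infDist q F ≤ dist q f := infDist_le_dist_of_mem hfF
    have h2 : dist q f < ρ := mem_ball.1 hqf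
    exact absurd (hqS.2.2.trans h1) (not_le.2 h2)
  have hwC : w ∈ C := ⟨mem_ball.2 hwf, hw⟩
  have hpC : p ∈ C := ⟨mem_ball'.2 hfp, hpU.1⟩
  have hpV : p ∈ Loewner.unboundedComponent (upperHalfPlaneSet \ erosion φ D' n) :=
    pullbackDomain_subset_unboundedComponent hφ hD' hsc n hpU
  have hpw : p ∈ connectedComponentIn (upperHalfPlaneSet \ erosion φ D' n) w :=
    hCconv.isPreconnected.subset_connectedComponentIn hwC hCsub hpC
  refine hwV ⟨hCsub hwC, ?_⟩
  rw [connectedComponentIn_eq hpw]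
  exact hpV.2

/-- **Metric margin on the anchored hulls of the erosions**: every point of
`B_n = anchoredHull (erosion φ D' n) ⊆ hpFill (erosion φ D' n)` is at distance `≥ 1/(n+1)` from
`closure (φ⁻¹ D')` (the margin set is closed and contains `ℍ` minus the unbounded component). [folklore] -/
theorem le_infDist_of_mem_anchoredHull_erosion {D D' : DobrushinDomain}
    {φ : ConformalEquiv upperHalfPlaneSet D.carrier} (hφ : D.IsChordalUniformizing φ)
    (hD' : D.IsHullSubdomain D') (n : ℕ) {w : ℂ} (hw : w ∈ anchoredHull (erosion φ D' n)) :
    1 / ((n : ℝ) + 1) ≤ infDist w (closure (φ.pullbackDomain D')) := by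
  have hw' : w ∈ hpFill (erosion φ D' n) := anchoredHull_subset_hpFill _ hw
  have hT : IsClosed {z : ℂ | 1 / ((n : ℝ) + 1) ≤ infDist z (closure (φ.pullbackDomain D'))} :=
    isClosed_le continuous_const (continuous_infDist_pt _)
  have hsubT : upperHalfPlaneSet \ Loewner.unboundedComponent (upperHalfPlaneSet \ erosion φ D' n) ⊆
      {z : ℂ | 1 / ((n : ℝ) + 1) ≤ infDist z (closure (φ.pullbackDomain D'))} :=
    fun z hz ↦ le_infDist_of_notMem_unboundedComponent hφ hD' n hz.1 hz.2
  exact hT.closure_subset_iff.2 hsubT hw'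

/-- **STUB 4a `stub_hullApproxLimit` (registered statement, verbatim) — the analytic half of the
hull approximation (HA).** Given the pulled-back `*`-hull `A = φ.pullbackHull D'` with restriction
map `Φ` and `Φ'_A(0) = d`, and `ε > 0`, there is a `*`-hull `B ⊆ A` at positive distance `r` from
`closure (φ⁻¹ D')` such that every pulled-back hull `A'' = φ.pullbackHull D'' ⊇ B` of a hull
subdomain `D''` has `Φ'_{A''}(0)^{5/8} ≤ (1 + ε) d^{5/8}`. Proof: `B = B_n = anchoredHull (erosion n)`
for `n` large, by kernel continuity `Φ'_{B_n}(0) → d > 0` ([LSW] proof of Lemma 3.5, Carathéodory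
kernel theorem; `HasRestrictionDeriv.tendsto_of_kernel_holds`) and monotonicity
`Φ'_{A''}(0) ≤ Φ'_{B_n}(0)` ([LSW] (2.4); `HasRestrictionDeriv.le_of_subset`), with `r = 1/(n+1)`.
[cite: LawlerSchrammWerner2003Restriction, proof of Lemma 3.5 (p. 12) with (2.4) p. 7] -/
theorem stub_hullApproxLimit :
    ∀ (D D' : DobrushinDomain) (φ : ConformalEquiv upperHalfPlaneSet D.carrier)
      (Φ : ConformalEquiv (upperHalfPlaneSet \ φ.pullbackHull D') upperHalfPlaneSet) (d : ℝ),
      D.IsHullSubdomain D' → D.IsChordalUniformizing φ →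
      IsRestrictionMap (φ.pullbackHull D') Φ → HasRestrictionDeriv (φ.pullbackHull D') Φ d →
      ∀ ε : ℝ, 0 < ε → ∃ (B : Set ℂ) (r : ℝ), IsStarHull B ∧ B ⊆ φ.pullbackHull D' ∧ 0 < r ∧
        (∀ w ∈ B, r ≤ infDist w (closure (φ.pullbackDomain D'))) ∧
        ∀ (D'' : DobrushinDomain)
          (Φ'' : ConformalEquiv (upperHalfPlaneSet \ φ.pullbackHull D'') upperHalfPlaneSet) (d'' : ℝ),
          D.IsHullSubdomain D'' → B ⊆ φ.pullbackHull D'' →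
          IsRestrictionMap (φ.pullbackHull D'') Φ'' → HasRestrictionDeriv (φ.pullbackHull D'') Φ'' d'' →
          d'' ^ ((5 : ℝ) / 8) ≤ (1 + ε) * d ^ ((5 : ℝ) / 8) := by
  intro D D' φ Φ d hD' hφ hΦ hd ε hε
  have hsc : ∀ D₀ : JordanDomain, D₀.isSimplyConnected := JordanDomain.isSimplyConnected_holds
  -- the hull `A` and `d = Φ'_A(0) > 0`
  have hA : IsStarHull (φ.pullbackHull D') := IsStarHull.pullbackHull hsc hφ hD'
  obtain ⟨d₀, hd₀, -, hd₀'⟩ := IsStarHull.exists_hasRestrictionDeriv_holds hA hΦ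
  have hdpos : 0 < d := by rw [hd.unique hA hd₀']; exact hd₀
  -- the exhaustion `B_n`, its restriction maps `Ψ n` and derivatives `dn n`
  set B : ℕ → Set ℂ := fun n ↦ anchoredHull (erosion φ D' n) with hB
  have hBstar : ∀ n, IsStarHull (B n) := fun n ↦
    isStarHull_anchoredHull_erosion hφ hD' hsc isSimplyConnected_of_isConnected_compl_holds n
  have hBsub : ∀ n, B n ⊆ φ.pullbackHull D' := fun n ↦ anchoredHull_erosion_subset hφ hD' hsc n
  have hBmono : Monotone B := fun n m h ↦ anchoredHull_mono (monotone_erosion h)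
  choose Ψ hΨ _huniq using fun n ↦ IsStarHull.existsUnique_isRestrictionMap_holds (hBstar n)
  choose dn _hdn0 _hdn1 hdn using fun n ↦ IsStarHull.exists_hasRestrictionDeriv_holds (hBstar n) (hΨ n)
  have hlim : Tendsto dn atTop (𝓝 d) :=
    HasRestrictionDeriv.tendsto_of_kernel_holds hA hBstar hBmono hBsub
      (interior_iInter_diff_anchoredHull_erosion hφ hD' hsc
        Literature.Topology.PlaneTopology.JordanCurveTheorem_holds
        JordanDomain.exists_continuousOn_extension_holds) hΦ hd hΨ hdn
  -- some `n` with `dn n ^ (5/8) < (1 + ε) d ^ (5/8)`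
  have hlim' : Tendsto (fun n ↦ dn n ^ ((5 : ℝ) / 8)) atTop (𝓝 (d ^ ((5 : ℝ) / 8))) :=
    hlim.rpow_const (Or.inr (by norm_num))
  have hdlt : d ^ ((5 : ℝ) / 8) < (1 + ε) * d ^ ((5 : ℝ) / 8) := by
    have h58 : 0 < d ^ ((5 : ℝ) / 8) := Real.rpow_pos_of_pos hdpos _
    nlinarith
  obtain ⟨n, hn⟩ := (hlim'.eventually (gt_mem_nhds hdlt)).exists
  refine ⟨B n, 1 / ((n : ℝ) + 1), hBstar n, hBsub n, by positivity,
    fun w hw ↦ le_infDist_of_mem_anchoredHull_erosion hφ hD' n hw, ?_⟩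
  -- monotonicity of `Φ'_·(0)` in the hull
  intro D'' Φ'' d'' hD'' hBD'' hΦ'' hd''
  have hA'' : IsStarHull (φ.pullbackHull D'') := IsStarHull.pullbackHull hsc hφ hD''
  have hle : d'' ≤ dn n :=
    HasRestrictionDeriv.le_of_subset hA'' (hBstar n) hBD'' hΦ'' (hΨ n) hd'' (hdn n)
  obtain ⟨e, he0, -, he⟩ := IsStarHull.exists_hasRestrictionDeriv_holds hA'' hΦ''
  have hd''0 : 0 ≤ d'' := by rw [hd''.unique hA'' he]; exact he0.le
  calc d'' ^ ((5 : ℝ) / 8) ≤ dn n ^ ((5 : ℝ) / 8) := Real.rpow_le_rpow hd''0 hle (by norm_num)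
    _ ≤ (1 + ε) * d ^ ((5 : ℝ) / 8) := hn.le

end Summit.CriticalPhenomena.SAWScalingLimit.Theorems.ObservableToSLE.FloorRatio

end
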